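import Summits.Ventures.DiscreteObjects.Hadamard.FixedSubmatrix23
import Summits.Ventures.DiscreteObjects.Hadamard.HadamardOrbitCounts668
import Summits.Ventures.DiscreteObjects.Hadamard.ResignOddOrder
import Summits.Ventures.DiscreteObjects.Hadamard.BesselBurnside
import Summits.Ventures.DiscreteObjects.Hadamard.CompositeOrderTools

/-!
# Hadamard 668 census, family F12 — counting and rank constraints for automorphisms of order 23·q (kernel)

Framing: lottery ticket; floor = certified bounds/negative ranges.

Cell pub-namedobj (venture DiscreteObjects), target (H), hadamard gen 11 (HANDOFF-H-g10 item 0 = FAMILY-F12-G10 §8(j),(m),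
with a NEW frame-free proof).  Let `H` be a Hadamard matrix of order `668` with a PERMUTATION automorphism pair `(π, κ)`
(`H (π i) (κ j) = H i j`) with `π^(23q) = κ^(23q) = 1`, `q ∈ {5, 7, 11}`, whose `23`-part `(π^q, κ^q)` and `q`-part
`(π^23, κ^23)` are both nontrivial.  By `hadamard668_fixedRows_23` the `23`-part fixes `1 + 1` or `24 + 24` rows/columns.
* COUNTING (`structure_cols`): the `q`-part `h = κ^23` commutes with `σ = κ^q`, so an `h`-fixed `σ`-moved column has its whole
  `σ`-orbit `h`-fixed (`dvd_card_moved_fixed`: `23 ∣ x₁`); `#(σ-fixed ∩ h-fixed) ≡ #σ-fixed (mod q)` (`card_fixed_on_mod`); and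
  `#h-fixed = 668 − q·m` with `m` even in the census window (`hadamard668_signedAut_colClasses_window`).
* RANK (`ineq_24type`, the 24-type): the `24 × 644` block fixed rows × moved columns has orthogonal rows of norm `644`
  (`hadamard668_fixedSubmatrix_23`) and is equivariant under `(π, κ)`; the Bessel–Burnside inequality `sum_card_fixed_le`
  (`∑_{k<23q} #fix_R(π^k) ≤ ∑_{k<23q} #fix_X(κ^k)`) evaluates (`card_fixedRows_pow`, `card_movedCols_pow`, `count_multiples`)
  to **`552 + (23q − 23)·f'_r ≤ 644 + (q − 1)·x₁`**, `f'_r = #(π^q-fixed ∩ π^23-fixed rows)`, `x₁ = #(κ^q-moved ∩ κ^23-fixed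
  columns)`.
The conclusions (orders 253, 115, 161) are drawn in `CompositeOrder23`.  Ours, not literature; no `sorry`, no `decide`.
-/

namespace Summit.Ventures.DiscreteObjects.Hadamard

open Finset BigOperators Matrix

open Literature.Combinatorics.Designs.GoethalsSeidel (IsHadamardMatrix)

variable {ι : Type*} [Fintype ι] [DecidableEq ι]

section unsigned
variable {H : Matrix ι ι ℤ} {π κ : Equiv.Perm ι}

omit [Fintype ι] [DecidableEq ι] in
/-- powers of an unsigned automorphism pair, as signed automorphisms with trivial signs -/
lemma isSignedAut_pow_of_unsigned (hA : ∀ i j, H (π i) (κ j) = H i j) (k : ℕ) :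
    IsSignedAut H (π ^ k) (κ ^ k) (fun _ => 1) (fun _ => 1) :=
  ⟨fun _ => Or.inl rfl, fun _ => Or.inl rfl, fun i j => by
    rw [one_mul, one_mul]; exact aut_pow_apply (fun i j => H i j) π κ hA k i j⟩

omit [Fintype ι] [DecidableEq ι] in
/-- `σ^q` commutes with `σ` pointwise -/
lemma pow_apply_comm (σ : Equiv.Perm ι) (q : ℕ) (i : ι) : (σ ^ q) (σ i) = σ ((σ ^ q) i) := by
  have := perm_pow_comm_apply σ q 1 i
  rwa [pow_one] at this

/-- **Counting constraints (columns).**  For an unsigned automorphism pair of order `23 q`, `q ∈ {5, 7, 11}`: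
the `23`-part fixes `1` or `24` columns (as many as rows); the `q`-part fixes `668 − q m` columns with `m` even in the census
window; these split as `x₁` (moved by the `23`-part, `23 ∣ x₁`) plus `f'` (fixed by it, `f' ≡ #σ-fixed (mod q)`). -/
lemma structure_cols (hH : IsHadamardMatrix H) (hι : Fintype.card ι = 668) (hA : ∀ i j, H (π i) (κ j) = H i j)
    {q : ℕ} (hq : q = 5 ∨ q = 7 ∨ q = 11) (hπ : π ^ (23 * q) = 1) (hκ : κ ^ (23 * q) = 1)
    (hσ : π ^ q ≠ 1 ∨ κ ^ q ≠ 1) (hh : π ^ 23 ≠ 1 ∨ κ ^ 23 ≠ 1) :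
    ((univ.filter fun j => (κ ^ q) j = j).card = 1 ∨ (univ.filter fun j => (κ ^ q) j = j).card = 24) ∧
    (univ.filter fun i => (π ^ q) i = i).card = (univ.filter fun j => (κ ^ q) j = j).card ∧
    (∃ m : ℕ, 2 ∣ m ∧ (univ.filter fun j => (κ ^ 23) j = j).card + m * q = 668 ∧
      (q = 5 → 112 ≤ m ∧ m ≤ 132) ∧ (q = 7 → 84 ≤ m ∧ m ≤ 94) ∧ (q = 11 → 56 ≤ m ∧ m ≤ 60)) ∧
    (univ.filter fun j => (κ ^ 23) j = j).card
      = (univ.filter fun j => (κ ^ q) j ≠ j ∧ (κ ^ 23) j = j).card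
        + (univ.filter fun j => (κ ^ q) j = j ∧ (κ ^ 23) j = j).card ∧
    23 ∣ (univ.filter fun j => (κ ^ q) j ≠ j ∧ (κ ^ 23) j = j).card ∧
    (univ.filter fun j => (κ ^ q) j = j ∧ (κ ^ 23) j = j).card % q
      = (univ.filter fun j => (κ ^ q) j = j).card % q ∧
    (univ.filter fun j => (κ ^ q) j = j ∧ (κ ^ 23) j = j).card ≤ (univ.filter fun j => (κ ^ q) j = j).card := by
  have hqp : q.Prime := by rcases hq with rfl | rfl | rfl <;> norm_num
  have hπ1 : (π ^ q) ^ 23 = 1 := by rw [← pow_mul, mul_comm]; exact hπ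
  have hκ1 : (κ ^ q) ^ 23 = 1 := by rw [← pow_mul, mul_comm]; exact hκ
  have hπ2 : (π ^ 23) ^ q = 1 := by rw [← pow_mul]; exact hπ
  have hκ2 : (κ ^ 23) ^ q = 1 := by rw [← pow_mul]; exact hκ
  have fix23 := hadamard668_fixedRows_23 hH hι (π ^ q) (κ ^ q) _ _ (isSignedAut_pow_of_unsigned hA q) hπ1 hκ1 hσ
  obtain ⟨h2, -, w5, w7, w11⟩ := hadamard668_signedAut_colClasses_window hH hι (Or.inr hq) (π ^ 23) (κ ^ 23) _ _
    (isSignedAut_pow_of_unsigned hA 23) hπ2 hκ2 hh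
  have hcl := card_fixed_add_classes (κ ^ 23) hqp hκ2
  rw [hι] at hcl
  refine ⟨?_, ?_, ⟨(blockClasses (κ ^ 23) q).card, h2, hcl, w5, w7, w11⟩, ?_, ?_, ?_, ?_⟩
  · rcases fix23 with ⟨-, h⟩ | ⟨-, h⟩
    · exact Or.inl h
    · exact Or.inr h
  · rcases fix23 with ⟨h1, h⟩ | ⟨h1, h⟩ <;> rw [h1, h]
  · rw [card_filter_split (fun j => (κ ^ 23) j = j) (fun j => (κ ^ q) j = j), add_comm]
    have e1 : (univ.filter fun j => (κ ^ 23) j = j ∧ ¬ (κ ^ q) j = j)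
        = univ.filter fun j => (κ ^ q) j ≠ j ∧ (κ ^ 23) j = j :=
      Finset.filter_congr (fun j _ => ⟨fun h => ⟨h.2, h.1⟩, fun h => ⟨h.2, h.1⟩⟩)
    have e2 : (univ.filter fun j => (κ ^ 23) j = j ∧ (κ ^ q) j = j)
        = univ.filter fun j => (κ ^ q) j = j ∧ (κ ^ 23) j = j :=
      Finset.filter_congr (fun j _ => ⟨fun h => ⟨h.2, h.1⟩, fun h => ⟨h.2, h.1⟩⟩)
    rw [e1, e2]
  · exact dvd_card_moved_fixed (κ ^ q) (κ ^ 23) (by norm_num) hκ1 (fun j => perm_pow_comm_apply κ q 23 j)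
  · apply card_fixed_on_mod (κ ^ 23) hqp hκ2 (fun j => (κ ^ q) j = j)
    intro j
    rw [perm_pow_comm_apply κ q 23 j]
    exact (κ ^ 23).apply_eq_iff_eq
  · apply Finset.card_le_card
    intro j
    simp only [Finset.mem_filter, Finset.mem_univ, true_and]
    exact And.left

omit [Fintype ι] [DecidableEq ι] in
/-- the transposed automorphism pair -/
lemma unsigned_transpose (hA : ∀ i j, H (π i) (κ j) = H i j) : ∀ j i, Hᵀ (κ j) (π i) = Hᵀ j i := by
  intro j i
  rw [Matrix.transpose_apply, Matrix.transpose_apply, hA]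

end unsigned

section rank
variable {H : Matrix ι ι ℤ} {π κ : Equiv.Perm ι}

/-- multiples of `b` below `a * b`: there are `a` of them -/
lemma card_fin_filter_dvd {n a b : ℕ} (hn : n = a * b) (hb : 0 < b) :
    (univ.filter fun m : Fin n => b ∣ m.val).card = a := by
  subst hn
  have hlt : ∀ t : Fin a, b * t.val < a * b := by
    intro t
    rw [mul_comm a b]
    exact Nat.mul_lt_mul_of_pos_left t.2 hb
  have h : (univ.filter fun m : Fin (a * b) => b ∣ m.val)
      = (univ : Finset (Fin a)).image (fun t => (⟨b * t.val, hlt t⟩ : Fin (a * b))) := by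
    ext m
    simp only [Finset.mem_filter, Finset.mem_univ, true_and, Finset.mem_image]
    constructor
    · rintro ⟨c, hc⟩
      have hca : c < a := by
        have h1 : b * c < a * b := by rw [← hc]; exact m.2
        rw [mul_comm a b] at h1
        exact lt_of_mul_lt_mul_left h1 b.zero_le
      exact ⟨⟨c, hca⟩, Fin.ext hc.symm⟩
    · rintro ⟨t, ht⟩
      exact ⟨t.val, by rw [← ht]⟩
  rw [h, Finset.card_image_of_injective, Finset.card_univ, Fintype.card_fin]
  intro t t' htt
  have := congrArg Fin.val htt
  exact Fin.ext (Nat.eq_of_mul_eq_mul_left hb this)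

/-- exactly one element of `Fin n` has value `0` -/
lemma card_fin_filter_eq_zero {n : ℕ} [NeZero n] : (univ.filter fun m : Fin n => m.val = 0).card = 1 := by
  rw [Finset.card_eq_one]
  refine ⟨0, ?_⟩
  ext m
  simp only [Finset.mem_filter, Finset.mem_univ, true_and, Finset.mem_singleton]
  exact ⟨fun h => Fin.ext h, fun h => by rw [h]; rfl⟩

/-- counting below `23 q`: multiples of `q`, non-multiples, zero, nonzero multiples of `23` -/
lemma count_multiples {q : ℕ} (hq0 : 0 < q) :
    (univ.filter fun m : Fin (23 * q) => q ∣ m.val).card = 23 ∧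
    (univ.filter fun m : Fin (23 * q) => ¬ q ∣ m.val).card = 23 * q - 23 ∧
    (univ.filter fun m : Fin (23 * q) => m.val = 0).card = 1 ∧
    (univ.filter fun m : Fin (23 * q) => ¬ m.val = 0 ∧ 23 ∣ m.val).card = q - 1 := by
  haveI : NeZero (23 * q) := ⟨by omega⟩
  have c1 : (univ.filter fun m : Fin (23 * q) => q ∣ m.val).card = 23 := card_fin_filter_dvd rfl hq0
  have c3 : (univ.filter fun m : Fin (23 * q) => m.val = 0).card = 1 := card_fin_filter_eq_zero
  have c23 : (univ.filter fun m : Fin (23 * q) => 23 ∣ m.val).card = q :=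
    card_fin_filter_dvd (mul_comm 23 q) (by norm_num)
  refine ⟨c1, ?_, c3, ?_⟩
  · have hs := Finset.card_filter_add_card_filter_not (s := (univ : Finset (Fin (23 * q)))) (fun m => q ∣ m.val)
    rw [Finset.card_univ, Fintype.card_fin, c1] at hs
    omega
  · have hs := card_filter_split (fun m : Fin (23 * q) => 23 ∣ m.val) (fun m => m.val = 0)
    have e1 : (univ.filter fun m : Fin (23 * q) => 23 ∣ m.val ∧ m.val = 0) = univ.filter fun m => m.val = 0 :=
      Finset.filter_congr (fun m _ => ⟨fun h => h.2, fun h => ⟨by rw [h]; exact dvd_zero 23, h⟩⟩)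
    have e2 : (univ.filter fun m : Fin (23 * q) => 23 ∣ m.val ∧ ¬ m.val = 0)
        = univ.filter fun m => ¬ m.val = 0 ∧ 23 ∣ m.val :=
      Finset.filter_congr (fun m _ => ⟨fun h => ⟨h.2, h.1⟩, fun h => ⟨h.2, h.1⟩⟩)
    rw [c23, e1, e2, c3] at hs
    omega

omit [Fintype ι] [DecidableEq ι] in
/-- fixed points of a power that is a power of `σ^b` -/
lemma pow_fixed_of_dvd (σ : Equiv.Perm ι) {b m : ℕ} (h : b ∣ m) {i : ι} (hi : (σ ^ b) i = i) : (σ ^ m) i = i := by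
  obtain ⟨t, rfl⟩ := h
  rw [pow_mul]
  exact perm_pow_apply_of_fixed _ hi t

/-- **Row side of the rank inequality (24-type).**  For `m < 23q`: the rows fixed by `π^q` and by `π^m` number `24` if
`q ∣ m`, and `f'_r = #(π^q-fixed ∩ π^23-fixed)` otherwise. -/
lemma card_fixedRows_pow {q : ℕ} (hq : q = 5 ∨ q = 7 ∨ q = 11)
    (h24 : (univ.filter fun i => (π ^ q) i = i).card = 24) (m : ℕ) :
    (univ.filter fun i => (π ^ q) i = i ∧ (π ^ m) i = i).card
      = if q ∣ m then 24 else (univ.filter fun i => (π ^ q) i = i ∧ (π ^ 23) i = i).card := by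
  have hqp : q.Prime := by rcases hq with rfl | rfl | rfl <;> norm_num
  have h23q : Nat.Coprime 23 q := by rcases hq with rfl | rfl | rfl <;> norm_num
  split_ifs with hdvd
  · rw [← h24]
    congr 1
    apply Finset.filter_congr
    intro i _
    constructor
    · exact And.left
    · intro hi
      exact ⟨hi, pow_fixed_of_dvd π hdvd hi⟩
  · congr 1
    apply Finset.filter_congr
    intro i _
    have hcop : Nat.Coprime m q := Nat.coprime_comm.mp ((Nat.Prime.coprime_iff_not_dvd hqp).mpr hdvd)
    constructor
    · rintro ⟨hi, hm⟩
      exact ⟨hi, perm_pow_apply_of_fixed π (perm_fixed_of_pow_coprime π hcop hqp.one_lt hm hi) 23⟩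
    · rintro ⟨hi, hm⟩
      exact ⟨hi, perm_pow_apply_of_fixed π (perm_fixed_of_pow_coprime π h23q hqp.one_lt hm hi) m⟩

/-- **Column side of the rank inequality.**  For `0 < m < 23q`: the columns moved by `κ^q` and fixed by `κ^m` number
`x₁ = #(κ^q-moved ∩ κ^23-fixed)` if `23 ∣ m`, and `0` otherwise; for `m = 0` they number `668 − #κ^q-fixed`. -/
lemma card_movedCols_pow (hι : Fintype.card ι = 668) {q : ℕ} (hq : q = 5 ∨ q = 7 ∨ q = 11) (hκ : κ ^ (23 * q) = 1)
    (m : ℕ) (hm : m < 23 * q) :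
    (univ.filter fun j => (κ ^ q) j ≠ j ∧ (κ ^ m) j = j).card
      = if m = 0 then 668 - (univ.filter fun j => (κ ^ q) j = j).card
        else if 23 ∣ m then (univ.filter fun j => (κ ^ q) j ≠ j ∧ (κ ^ 23) j = j).card else 0 := by
  have hqp : q.Prime := by rcases hq with rfl | rfl | rfl <;> norm_num
  have hκ1 : (κ ^ q) ^ 23 = 1 := by rw [← pow_mul, mul_comm]; exact hκ
  have hκ2 : (κ ^ 23) ^ q = 1 := by rw [← pow_mul]; exact hκ
  split_ifs with h0 h23
  · subst h0
    have hs := Finset.card_filter_add_card_filter_not (s := (univ : Finset ι)) (fun j => (κ ^ q) j = j)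
    rw [Finset.card_univ, hι] at hs
    have e : (univ.filter fun j => (κ ^ q) j ≠ j ∧ (κ ^ 0) j = j) = univ.filter fun j => ¬ (κ ^ q) j = j := by
      apply Finset.filter_congr; intro j _; simp
    rw [e]
    omega
  · obtain ⟨m', rfl⟩ := h23
    have hm'pos : 0 < m' := by
      rcases Nat.eq_zero_or_pos m' with h | h
      · subst h; simp at h0
      · exact h
    have hm'lt : m' < q := by
      by_contra hc
      have : 23 * q ≤ 23 * m' := Nat.mul_le_mul_left 23 (not_lt.mp hc)
      omega
    have hcop : Nat.Coprime m' q :=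
      Nat.coprime_comm.mp ((Nat.Prime.coprime_iff_not_dvd hqp).mpr (Nat.not_dvd_of_pos_of_lt hm'pos hm'lt))
    congr 1
    apply Finset.filter_congr
    intro j _
    rw [pow_mul]
    have hbx : ((κ ^ 23) ^ q) j = j := by rw [hκ2]; rfl
    exact and_congr_right fun _ => perm_pow_fixed_iff_of_coprime (κ ^ 23) hcop hqp.one_lt hbx
  · rw [Finset.card_eq_zero, Finset.filter_eq_empty_iff]
    rintro j - ⟨hj, hjm⟩
    apply hj
    have hcop : Nat.Coprime m 23 :=
      Nat.coprime_comm.mp ((Nat.Prime.coprime_iff_not_dvd (by norm_num)).mpr h23)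
    have h1 : ((κ ^ q) ^ m) j = j := by
      rw [← pow_mul, mul_comm, pow_mul]
      exact perm_pow_apply_of_fixed _ hjm q
    have h2 : ((κ ^ q) ^ 23) j = j := by rw [hκ1]; rfl
    exact perm_fixed_of_pow_coprime (κ ^ q) hcop (by norm_num) h1 h2

/-- **The rank inequality in the 24-type** (Bessel–Burnside on the `24 × 644` block fixed rows × moved columns):
`24·23 + f'_r·(23q − 23) ≤ 644 + x₁·(q − 1)`. -/
lemma ineq_24type (hH : IsHadamardMatrix H) (hι : Fintype.card ι = 668) (hA : ∀ i j, H (π i) (κ j) = H i j)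
    {q : ℕ} (hq : q = 5 ∨ q = 7 ∨ q = 11) (hπ : π ^ (23 * q) = 1) (hκ : κ ^ (23 * q) = 1)
    (h24r : (univ.filter fun i => (π ^ q) i = i).card = 24) (h24c : (univ.filter fun j => (κ ^ q) j = j).card = 24) :
    (24 * 23 + (univ.filter fun i => (π ^ q) i = i ∧ (π ^ 23) i = i).card * (23 * (q : ℤ) - 23) : ℤ)
      ≤ 644 + (univ.filter fun j => (κ ^ q) j ≠ j ∧ (κ ^ 23) j = j).card * ((q : ℤ) - 1) := by
  have hqp : q.Prime := by rcases hq with rfl | rfl | rfl <;> norm_num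
  have hq5 : 5 ≤ q := by rcases hq with rfl | rfl | rfl <;> norm_num
  haveI : NeZero (23 * q) := ⟨by omega⟩
  have hκ1 : (κ ^ q) ^ 23 = 1 := by rw [← pow_mul, mul_comm]; exact hκ
  have hπ1 : (π ^ q) ^ 23 = 1 := by rw [← pow_mul, mul_comm]; exact hπ
  -- the restricted permutations
  have hR : ∀ i, (π ^ q) (π i) = π i ↔ (π ^ q) i = i := by
    intro i; rw [pow_apply_comm π q i]; exact π.apply_eq_iff_eq
  have hX : ∀ j, (κ ^ q) (κ j) ≠ κ j ↔ (κ ^ q) j ≠ j := by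
    intro j; rw [pow_apply_comm κ q j]; exact not_congr κ.apply_eq_iff_eq
  set α : Equiv.Perm {i // (π ^ q) i = i} := π.subtypePerm hR with hαdef
  set β : Equiv.Perm {j // (κ ^ q) j ≠ j} := κ.subtypePerm hX with hβdef
  have hα : α ^ (23 * q) = 1 := by ext x; simp [hαdef, Equiv.Perm.subtypePerm_pow, hπ]
  have hβ : β ^ (23 * q) = 1 := by ext x; simp [hβdef, Equiv.Perm.subtypePerm_pow, hκ]
  -- the block and its Gram identity
  set M : Matrix {i // (π ^ q) i = i} {j // (κ ^ q) j ≠ j} ℤ := Matrix.of fun u x => H u.1 x.1 with hMdef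
  have hsub := (hadamard668_fixedSubmatrix_23 hH hι (π ^ q) (κ ^ q) _ _ (isSignedAut_pow_of_unsigned hA q)
    hπ1 hκ1 h24c).2
  have hM : M * Mᵀ = (644 : ℤ) • (1 : Matrix {i // (π ^ q) i = i} {i // (π ^ q) i = i} ℤ) := by
    ext u u'
    rw [Matrix.mul_apply, Matrix.smul_apply, smul_eq_mul]
    simp only [Matrix.transpose_apply, hMdef, Matrix.of_apply]
    have e := ((hsub u.1 u'.1 u.2 u'.2).2)
    rw [Finset.sum_subtype (univ.filter fun j => (κ ^ q) j ≠ j) (p := fun j => (κ ^ q) j ≠ j) (fun j => by simp)]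
      at e
    rw [e, Matrix.one_apply]
    by_cases huu : u = u'
    · subst huu; simp
    · rw [if_neg (fun h => huu (Subtype.ext h)), if_neg huu, mul_zero]
  have heq : ∀ u x, M (α u) (β x) = M u x := by
    intro u x
    simp only [hMdef, hαdef, hβdef, Matrix.of_apply, Equiv.Perm.subtypePerm_apply]
    exact hA u.1 x.1
  have ineq := sum_card_fixed_le M (by norm_num) hM α β hα hβ heq
  -- translate the counts to the ambient type
  have eR : ∀ mm : Fin (23 * q), ((univ.filter fun u : {i // (π ^ q) i = i} => (α ^ mm.val) u = u).card : ℤ)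
      = if q ∣ mm.val then (24 : ℤ) else ((univ.filter fun i => (π ^ q) i = i ∧ (π ^ 23) i = i).card : ℤ) := by
    intro mm
    rw [hαdef, card_filter_subtypePerm_pow π (fun i => (π ^ q) i = i) hR mm.val, card_fixedRows_pow hq h24r mm.val]
    split_ifs <;> simp
  have eX : ∀ mm : Fin (23 * q), ((univ.filter fun x : {j // (κ ^ q) j ≠ j} => (β ^ mm.val) x = x).card : ℤ)
      = if mm.val = 0 then (644 : ℤ) else
          if 23 ∣ mm.val then ((univ.filter fun j => (κ ^ q) j ≠ j ∧ (κ ^ 23) j = j).card : ℤ) else 0 := by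
    intro mm
    rw [hβdef, card_filter_subtypePerm_pow κ (fun j => (κ ^ q) j ≠ j) hX mm.val,
      card_movedCols_pow hι hq hκ mm.val mm.2, h24c]
    split_ifs <;> simp
  rw [Finset.sum_congr rfl fun mm _ => eR mm, Finset.sum_congr rfl fun mm _ => eX mm] at ineq
  rw [Finset.sum_ite, Finset.sum_const, Finset.sum_const] at ineq
  rw [Finset.sum_ite, Finset.sum_const, Finset.sum_ite, Finset.sum_const, Finset.sum_const, Finset.filter_filter]
    at ineq
  obtain ⟨c1, c2, c3, c4⟩ := count_multiples (q := q) (by omega)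
  rw [c1, c2, c3, c4] at ineq
  simp only [nsmul_eq_mul, mul_zero, add_zero] at ineq
  have hq2 : ((23 * q - 23 : ℕ) : ℤ) = 23 * (q : ℤ) - 23 := by
    rw [Nat.cast_sub (by omega : 23 ≤ 23 * q)]; push_cast; ring
  have hq1 : ((q - 1 : ℕ) : ℤ) = (q : ℤ) - 1 := by
    rw [Nat.cast_sub (by omega : 1 ≤ q)]; push_cast; ring
  rw [hq1, hq2] at ineq
  simp only [Nat.cast_ofNat, Nat.cast_one, one_mul] at ineq
  linarith

end rank

end Summit.Ventures.DiscreteObjects.Hadamard
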